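/-
Copyright (c) 2026 the pub-hodgecm-mathlib formalisation cell (harness21).  Prover seat hodgecm-mathlib-LH4-p12 (g4), Track A «(D-RAM) FOUR-FRAME», unit U2H, the census leaf
(ρ2b′-X) `stub_U2H_fixedPointCensus_typeTwo_unit0` — RHO2BX-ORDER v1 (payer LH4-p14 (g3)) organ O-Cone, M-side hinge lemmas (A)(B)(C′) of the level-`b` transport.  2026-09-04.
-/
import Literature.NumberTheory.LocalFields.QuadraticOrderNormLine   -- ★ p857156 (F3) → ★ p857067 (T4c `Λ^# = y⁻¹Λ`) → ★ p857040 ∕ p857021 (T4: orders, Mars, multipliers)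
import HarnessLib

/-!
# The discriminant module of an order lattice: for `Λ = x₀·(𝒪^ρ + c𝒪)` with dual generator `y`, (A) `Λ^# = Λ + 𝒪^ρ·(y⁻¹x₀)` iff `y` is GRAM-PRIMITIVE, (B) `Λ^## = Λ`,
# (C′) the dual generator pairs to `|y − ρy| ∕ (|y|²·|c(α − ρα)|)`, which is `|y|⁻²` off level `0` (Jacobowitz 1962 §4; Serre, *Local Fields* III §6, V §3)

Topic `NumberTheory/LocalFields`; namespace `Literature.NumberTheory.LocalFields.QuadraticOrder` (= ★ T4 p857021 ∕ p857040 ∕ p857067 ∕ p857156).  THEOREMS ONLY (no definition, no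
instance, no notation, no named fact, no `sorry`); kernel lane `--supports stmt-HodgeConjecture-24833` (count-neutral).  Cell `pub/hodgecm-mathlib` (D-0151), crux H413, Track A
«(D-RAM) FOUR-FRAME», unit U2H: RHO2BX-ORDER v1 (payer LH4-p14 (g3)) — these are the three M-side facts on which the level-`b` twin of ★ T3-T (C) (`EllipticPlaneAsFieldLine`) and
the payer's glue-fibre count T2b (`UnitaryLatticeTreeBlockGlueFibreCount`: binders `hG1 : B = (B + 𝒪w₀)^♯ ∩ W`, `hw₀ : |⟨w₀, w₀⟩|·|ϖ|^{2b} = 1`) hinge: with `Λ = x₀·𝒪_c` and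
`y = h·x₀Θ(x₀)·c(α − ρα)` (★ T4c: `Λ^# = y⁻¹Λ`), the dual generator is `w₀ := y⁻¹x₀`, and
* (A) **`Λ^# = Λ + 𝒪^ρ·w₀` ⟺ `y` GRAM-PRIMITIVE**: `y⁻¹x₀𝒪_c = x₀𝒪_c + 𝒪^ρ·y⁻¹x₀ ⟺ 𝒪_c = 𝒪^ρ + y·𝒪_c`, and writing `y = p + q·(cα)` in the integral power basis `1, cα` of `𝒪_c` this is
  the unimodularity of `(q, p + q·c(α + ρα))`, i.e. `|p| = 1 ∨ |q| = 1` — 2-free and type-free (§2);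
* (B) **`Λ^## = Λ`**: the dual generator of `y⁻¹x₀·𝒪_c` is `Θ(y)⁻¹`, and `Θ(y)∕y = (Θc∕c)·b(Θα)` is a fixed UNIT of `𝒪_c` (§3);
* (C′) **`⟨w₀, w₀⟩ = Tr_{M∕E}(h·Θ(w₀)·w₀)` has value `|y − ρy| ∕ (|y|²·|c(α − ρα)|)`** (`hΘ(w₀)w₀ = (y·Θ(c(α − ρα)))⁻¹ =: u` and `ρu = −(ρy·Θ(c(α − ρα)))⁻¹`, so `Tr u =
  (ρy − y)∕(y·ρy·Θ(c(α − ρα)))`), and a primitive NON-UNIT `y ∈ 𝒪_c` has `|y − ρy| = |c(α − ρα)|` EXACTLY, whence **`|⟨w₀, w₀⟩|·|y|² = 1`** — the tube coordinate `b` of T2b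
  (`|⟨w₀,w₀⟩| = |ϖ|^{−2b}`) is the level `|y| = |ϖE|^b` of the toric census (§4).
Primitivity is carried in COORDINATES (`y = p + q·(cα)`, `p q` fixed integers, `|p| = 1 ∨ |q| = 1`) and bridged to the sheets' `y∕ϖE ∉ 𝒪_c` under the frame hypothesis that
`|ϖE|` is the largest fixed value below `1` (§1).  Engine check (this seat, `e1/gen_norm_check.py` on g3's toric engine): `ord_E⟨w₀,w₀⟩ = −2a` on every primitive class with
`a ≥ 1` in the three wild types (U, RK, RM), and `⟨w₀,w₀⟩ = 0` exactly on the level-`0` classes with `y` fixed — as (C′) predicts.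
HONEST LABEL: HC_CM is proved only modulo the 7 printed citations (2 remaining named inputs: hLiu418 = stmt-HodgeConjecture-24832, h413 = stmt-HodgeConjecture-24833) until rung 0
closes; unconditional local algebra, count-neutral.

CURRENCY: ★ T4 — one field `K` (model of `M`) with `Valued K ℤᵐ⁰`, `ρ Θ : K →+* K` (`ρρ = id`, `ΘΘ = id`, `Θρ = ρΘ`, both isometric), `α` with `ρα ≠ α`, `|α| ≤ 1`, `hint`;
the order of conductor `c` (`ρc = c`, `0 < |c| ≤ 1`) = the spelled-out predicate `|z| ≤ 1 ∧ |z − ρz| ≤ |c(α − ρα)|`; `y = h·(x₀·Θx₀)·(c·(α − ρα))`.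

## References
* [Jacobowitz1962] R. Jacobowitz, *Hermitian forms over local fields*, Amer. J. Math. 84 (1962), §4 (dual lattices, modular components, their generators).
* [Serre1979] J.-P. Serre, *Local Fields*, GTM 67 (1979): Ch. III §6 Prop. 11–12 (power bases and duals), Ch. V §3 (trace and norm in a cyclic extension of prime degree).
-/

set_option autoImplicit false

open WithZero

namespace Literature.NumberTheory.LocalFields.QuadraticOrder

variable {K : Type*} [Field K] [Valued K ℤᵐ⁰] {ρ Θ : K →+* K} {α : K}

/-! ## §1 Coordinates in the order and the two readings of Gram-primitivity -/

/-- **COORDINATES IN THE ORDER**: `z` lies in the order of conductor `c` iff `z = p + q·(c·α)` with `p, q` fixed integers (★ `mem_order_iff_exists` + the integral coordinates of `w`).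
[cite: Serre1979, Ch. III §6 Prop. 12] -/
theorem exists_fixed_coords_iff_mem_order (hρρ : ∀ x, ρ (ρ x) = x) (hα : ρ α ≠ α) (hα1 : Valued.v α ≤ 1)
    (hint : ∀ z : K, Valued.v z ≤ 1 → Valued.v ((z - ρ z) / (α - ρ α)) ≤ 1) {c : K} (hc : ρ c = c) (hc0 : c ≠ 0) (hc1 : Valued.v c ≤ 1) (z : K) :
    (∃ p q : K, (ρ p = p ∧ Valued.v p ≤ 1) ∧ (ρ q = q ∧ Valued.v q ≤ 1) ∧ z = p + q * (c * α)) ↔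
      (Valued.v z ≤ 1 ∧ Valued.v (z - ρ z) ≤ Valued.v (c * (α - ρ α))) := by
  rw [mem_order_iff_exists hρρ hα hα1 hint hc hc0 hc1]
  constructor
  · rintro ⟨p, q, ⟨hp, hp1⟩, ⟨hq, hq1⟩, rfl⟩
    exact ⟨p, q * α, hp, hp1, by rw [map_mul]; exact mul_le_one' hq1 hα1, by ring⟩
  · rintro ⟨a, w, ha, ha1, hw1, rfl⟩
    refine ⟨a + c * (w - (w - ρ w) / (α - ρ α) * α), (w - ρ w) / (α - ρ α), ⟨?_, ?_⟩, ⟨map_bCoord hρρ α w, hint w hw1⟩, by ring⟩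
    · rw [map_add, map_mul, ha, hc, map_aCoord hρρ hα w]
    · refine (Valuation.map_add _ _ _).trans (max_le ha1 ?_)
      rw [map_mul]; exact mul_le_one' hc1 (v_aCoord_le_one hα1 hint hw1)

omit [Valued K ℤᵐ⁰] in
/-- The coordinates `p, q` of `y = p + q·(cα)` are `y`'s `a`- and `b`-coordinates: `q = b(y)∕c`, `p = a(y)` (so they are unique). [cite: Serre1979, Ch. III §6 Prop. 12] -/
theorem coords_eq_of_eq_add_mul (hα : ρ α ≠ α) {c : K} (hc : ρ c = c) (hc0 : c ≠ 0) {p q y : K} (hp : ρ p = p) (hq : ρ q = q) (hy : y = p + q * (c * α)) :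
    q = (y - ρ y) / (α - ρ α) / c ∧ p = y - (y - ρ y) / (α - ρ α) * α := by
  have hqc : ρ (q * c) = q * c := by rw [map_mul, hq, hc]
  have hy' : y = p + (q * c) * α := by rw [hy]; ring
  have hb : (y - ρ y) / (α - ρ α) = q * c := by rw [hy']; exact bCoord_fixed_add_fixed_mul hα hp hqc
  refine ⟨by rw [hb, mul_div_cancel_right₀ _ hc0], ?_⟩
  rw [hb, hy']; ring

/-- **PRIMITIVITY, TWO READINGS**: if `|ϖE|` is the largest value of a fixed element below `1` (`hϖmax`), then for `y = p + q·(cα)` in the order (`p, q` fixed integers):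
`y∕ϖE` lies in the order iff `|p| < 1 ∧ |q| < 1` — so «Gram-primitive» (`y∕ϖE ∉ 𝒪_c`) is `|p| = 1 ∨ |q| = 1`. [cite: Jacobowitz1962, §4] -/
theorem div_mem_order_iff_coords_lt_one (hρρ : ∀ x, ρ (ρ x) = x) (hα : ρ α ≠ α) (hα1 : Valued.v α ≤ 1)
    (hint : ∀ z : K, Valued.v z ≤ 1 → Valued.v ((z - ρ z) / (α - ρ α)) ≤ 1) {c : K} (hc : ρ c = c) (hc0 : c ≠ 0) (hc1 : Valued.v c ≤ 1)
    {ϖE : K} (hρϖ : ρ ϖE = ϖE) (hϖ0 : ϖE ≠ 0) (hϖ1 : Valued.v ϖE < 1) (hϖmax : ∀ t : K, ρ t = t → Valued.v t < 1 → Valued.v t ≤ Valued.v ϖE)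
    {p q : K} (hp : ρ p = p) (hq : ρ q = q) :
    (Valued.v ((p + q * (c * α)) / ϖE) ≤ 1 ∧ Valued.v ((p + q * (c * α)) / ϖE - ρ ((p + q * (c * α)) / ϖE)) ≤ Valued.v (c * (α - ρ α))) ↔
      (Valued.v p < 1 ∧ Valued.v q < 1) := by
  have hvϖ : 0 < Valued.v ϖE := zero_lt_iff.2 ((Valuation.ne_zero_iff _).2 hϖ0)
  have hrew : (p + q * (c * α)) / ϖE = p / ϖE + q / ϖE * (c * α) := by field_simp
  rw [hrew, ← exists_fixed_coords_iff_mem_order hρρ hα hα1 hint hc hc0 hc1]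
  constructor
  · rintro ⟨p', q', ⟨hp', hp'1⟩, ⟨hq', hq'1⟩, heq⟩
    have hρp : ρ (p / ϖE) = p / ϖE := by rw [map_div₀, hp, hρϖ]
    have hρq : ρ (q / ϖE) = q / ϖE := by rw [map_div₀, hq, hρϖ]
    obtain ⟨hq'', hp''⟩ := coords_eq_of_eq_add_mul hα hc hc0 hp' hq' heq
    obtain ⟨hq''', hp'''⟩ := coords_eq_of_eq_add_mul hα hc hc0 hρp hρq rfl
    have hpp : p / ϖE = p' := hp'''.trans hp''.symm
    have hqq : q / ϖE = q' := hq'''.trans hq''.symm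
    constructor
    · have h1 : Valued.v (p / ϖE) ≤ 1 := by rw [hpp]; exact hp'1
      rw [map_div₀, div_le_one₀ hvϖ] at h1
      exact lt_of_le_of_lt h1 hϖ1
    · have h1 : Valued.v (q / ϖE) ≤ 1 := by rw [hqq]; exact hq'1
      rw [map_div₀, div_le_one₀ hvϖ] at h1
      exact lt_of_le_of_lt h1 hϖ1
  · rintro ⟨hp1', hq1'⟩
    refine ⟨p / ϖE, q / ϖE, ⟨by rw [map_div₀, hp, hρϖ], ?_⟩, ⟨by rw [map_div₀, hq, hρϖ], ?_⟩, rfl⟩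
    · rw [map_div₀, div_le_one₀ hvϖ]; exact hϖmax p hp hp1'
    · rw [map_div₀, div_le_one₀ hvϖ]; exact hϖmax q hq hq1'

/-! ## §2 (A) `𝒪_c = 𝒪^ρ + y·𝒪_c` iff `y` is primitive; hence `Λ^# = Λ + 𝒪^ρ·(y⁻¹x₀)` -/

/-- **(A-core) `𝒪_c = 𝒪^ρ + y·𝒪_c` FOR A PRIMITIVE `y`**: if `y = p + q·(cα)` with fixed integers `p, q` and `|p| = 1 ∨ |q| = 1`, then every `z` in the order of conductor `c` is
`t + y·w` with `t` a fixed integer and `w` in the order (the pair `(q, p + q·c(α + ρα))` is unimodular; `(cα)² = c(α + ρα)·(cα) − c²αρα`). [cite: Jacobowitz1962, §4] [cite: Serre1979, Ch. III §6 Prop. 12] -/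
theorem exists_fixed_add_mul_of_primitive (hρρ : ∀ x, ρ (ρ x) = x) (hvρ : ∀ x, Valued.v (ρ x) = Valued.v x) (hα : ρ α ≠ α) (hα1 : Valued.v α ≤ 1)
    (hint : ∀ z : K, Valued.v z ≤ 1 → Valued.v ((z - ρ z) / (α - ρ α)) ≤ 1) {c : K} (hc : ρ c = c) (hc0 : c ≠ 0) (hc1 : Valued.v c ≤ 1)
    {p q : K} (hp : ρ p = p) (hp1 : Valued.v p ≤ 1) (hq : ρ q = q) (hq1 : Valued.v q ≤ 1) (hprim : Valued.v p = 1 ∨ Valued.v q = 1)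
    {z : K} (hz : Valued.v z ≤ 1 ∧ Valued.v (z - ρ z) ≤ Valued.v (c * (α - ρ α))) :
    ∃ t w : K, (ρ t = t ∧ Valued.v t ≤ 1) ∧ (Valued.v w ≤ 1 ∧ Valued.v (w - ρ w) ≤ Valued.v (c * (α - ρ α))) ∧ z = t + (p + q * (c * α)) * w := by
  -- the trace and norm tokens of `α`
  set s : K := α + ρ α with hs
  set n : K := α * ρ α with hn
  have hsfix : ρ s = s := by rw [hs, map_add, hρρ, add_comm]
  have hnfix : ρ n = n := by rw [hn, map_mul, hρρ, mul_comm]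
  have hs1 : Valued.v s ≤ 1 := (Valuation.map_add _ _ _).trans (max_le hα1 (by rw [hvρ]; exact hα1))
  have hn1 : Valued.v n ≤ 1 := by rw [hn, map_mul, hvρ]; exact mul_le_one' hα1 hα1
  have hαsq : α * α = s * α - n := by rw [hs, hn]; ring
  -- coordinates of `z`
  obtain ⟨zp, zq, ⟨hzp, hzp1⟩, ⟨hzq, hzq1⟩, rfl⟩ := (exists_fixed_coords_iff_mem_order hρρ hα hα1 hint hc hc0 hc1 z).2 hz
  -- a fixed integer `e` with `q·a′ + (p + q c s)·b′ = 1`: the unimodular pair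
  have hunit : ∃ a' b' : K, (ρ a' = a' ∧ Valued.v a' ≤ 1) ∧ (ρ b' = b' ∧ Valued.v b' ≤ 1) ∧ q * a' + (p + q * c * s) * b' = 1 := by
    rcases hprim with hpu | hqu
    · by_cases hqu' : Valued.v q = 1
      · have hq0 : q ≠ 0 := fun h0 => by rw [h0, map_zero] at hqu'; exact zero_ne_one hqu'
        exact ⟨q⁻¹, 0, ⟨by rw [map_inv₀, hq], by rw [map_inv₀, hqu', inv_one]⟩, ⟨map_zero ρ, by rw [map_zero]; exact zero_le_one⟩,
          by rw [mul_inv_cancel₀ hq0, mul_zero, add_zero]⟩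
      · -- `|q| < 1`: `p + qcs` is a unit
        have hqlt : Valued.v q < 1 := lt_of_le_of_ne hq1 hqu'
        have hsmall : Valued.v (q * c * s) < 1 := by
          rw [map_mul, map_mul]
          calc Valued.v q * Valued.v c * Valued.v s ≤ Valued.v q * 1 * 1 := by
                exact mul_le_mul' (mul_le_mul' le_rfl hc1) hs1
            _ = Valued.v q := by rw [mul_one, mul_one]
            _ < 1 := hqlt
        have hval : Valued.v (p + q * c * s) = 1 := by
          rw [Valuation.map_add_of_distinct_val _ (by rw [hpu]; exact hsmall.ne'), hpu, max_eq_left hsmall.le]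
        have hne : p + q * c * s ≠ 0 := fun h0 => by rw [h0, map_zero] at hval; exact zero_ne_one hval
        refine ⟨0, (p + q * c * s)⁻¹, ⟨map_zero ρ, by rw [map_zero]; exact zero_le_one⟩, ⟨?_, ?_⟩, ?_⟩
        · rw [map_inv₀, map_add, map_mul, map_mul, hp, hq, hc, hsfix]
        · rw [map_inv₀, hval, inv_one]
        · rw [mul_zero, zero_add, mul_inv_cancel₀ hne]
    · have hq0 : q ≠ 0 := fun h0 => by rw [h0, map_zero] at hqu; exact zero_ne_one hqu
      exact ⟨q⁻¹, 0, ⟨by rw [map_inv₀, hq], by rw [map_inv₀, hqu, inv_one]⟩, ⟨map_zero ρ, by rw [map_zero]; exact zero_le_one⟩,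
        by rw [mul_inv_cancel₀ hq0, mul_zero, add_zero]⟩
  obtain ⟨a', b', ⟨ha', ha'1⟩, ⟨hb', hb'1⟩, hbez⟩ := hunit
  -- `cα = a + y·(a′ + b′·cα)` with `a = −(p a′ − q b′ c² n)`, so `z = zp + zq·cα = (zp + zq a) + y·(zq (a′ + b′ cα))`
  refine ⟨zp - zq * (p * a' - q * b' * c ^ 2 * n), zq * (a' + b' * (c * α)), ⟨?_, ?_⟩, ?_, ?_⟩
  · simp only [map_sub, map_mul, map_pow, hzp, hzq, hp, ha', hq, hb', hc, hnfix]
  · refine (Valuation.map_sub _ _ _).trans (max_le hzp1 ?_)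
    rw [map_mul]
    refine mul_le_one' hzq1 ((Valuation.map_sub _ _ _).trans (max_le ?_ ?_))
    · rw [map_mul]; exact mul_le_one' hp1 ha'1
    · rw [map_mul, map_mul, map_mul, map_pow]
      exact mul_le_one' (mul_le_one' (mul_le_one' hq1 hb'1) (pow_le_one₀ zero_le hc1)) hn1
  · -- `zq·(a′ + b′cα)` lies in the order
    refine mul_mem_order hvρ (mem_order_of_fixed c hzq hzq1) ?_
    exact (exists_fixed_coords_iff_mem_order hρρ hα hα1 hint hc hc0 hc1 _).1 ⟨a', b', ⟨ha', ha'1⟩, ⟨hb', hb'1⟩, rfl⟩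
  · -- the algebra: uses `α² = sα − n` and the Bézout relation
    have key : (p + q * (c * α)) * (a' + b' * (c * α)) = (p * a' - q * b' * c ^ 2 * n) + (q * a' + (p + q * c * s) * b') * (c * α) := by
      have : q * (c * α) * (b' * (c * α)) = q * b' * c ^ 2 * (α * α) := by ring
      rw [show (p + q * (c * α)) * (a' + b' * (c * α)) = p * a' + p * (b' * (c * α)) + q * (c * α) * a' + q * (c * α) * (b' * (c * α)) by ring,
        this, hαsq]
      ring
    rw [show (p + q * (c * α)) * (zq * (a' + b' * (c * α))) = zq * ((p + q * (c * α)) * (a' + b' * (c * α))) by ring, key, hbez]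
    ring

/-- **(A) `Λ^# = Λ + 𝒪^ρ·w₀` FOR A PRIMITIVE DUAL GENERATOR** (`w₀ = y⁻¹x₀`, `y = h·x₀Θ(x₀)·c(α − ρα) = p + q·(cα)` with `|p| = 1 ∨ |q| = 1`): `m` pairs integrally with all of
`Λ = x₀·𝒪_c` under `Tr(h·Θ(a)·m)` iff `m = a + t·(y⁻¹x₀)` with `a ∈ Λ` and `t` a fixed integer — ★ T4c `Λ^# = y⁻¹Λ` + (A-core).  This is T2b's binder (G1) «`B = (B + 𝒪w₀)^♯`»
read on `M`. [cite: Jacobowitz1962, §4] -/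
theorem forall_mem_herm_iff_exists_add_fixed_mul (hρρ : ∀ x, ρ (ρ x) = x) (hvρ : ∀ x, Valued.v (ρ x) = Valued.v x) (hα : ρ α ≠ α) (hα1 : Valued.v α ≤ 1)
    (hint : ∀ z : K, Valued.v z ≤ 1 → Valued.v ((z - ρ z) / (α - ρ α)) ≤ 1)
    (hΘΘ : ∀ x, Θ (Θ x) = x) (hΘρ : ∀ x, Θ (ρ x) = ρ (Θ x)) (hvΘ : ∀ x, Valued.v (Θ x) = Valued.v x)
    {c : K} (hc : ρ c = c) (hc0 : c ≠ 0) (hc1 : Valued.v c ≤ 1) {h : K} (hh : h ≠ 0) {Λ : AddSubgroup K} {x₀ : K} (hx₀ : x₀ ≠ 0)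
    (hΛ : ∀ x, x ∈ Λ ↔ ∃ z, (Valued.v z ≤ 1 ∧ Valued.v (z - ρ z) ≤ Valued.v (c * (α - ρ α))) ∧ x = x₀ * z)
    {p q : K} (hp : ρ p = p) (hp1 : Valued.v p ≤ 1) (hq : ρ q = q) (hq1 : Valued.v q ≤ 1) (hprim : Valued.v p = 1 ∨ Valued.v q = 1)
    (hy : h * (x₀ * Θ x₀) * (c * (α - ρ α)) = p + q * (c * α)) (m : K) :
    (∀ a ∈ Λ, Valued.v (h * Θ a * m + ρ (h * Θ a * m)) ≤ 1) ↔
      ∃ a t : K, a ∈ Λ ∧ (ρ t = t ∧ Valued.v t ≤ 1) ∧ m = a + t * ((h * (x₀ * Θ x₀) * (c * (α - ρ α)))⁻¹ * x₀) := by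
  have hd : α - ρ α ≠ 0 := sub_ne_zero.2 (Ne.symm hα)
  have hΘx₀ : Θ x₀ ≠ 0 := (map_ne_zero Θ).2 hx₀
  have hyO : Valued.v (h * (x₀ * Θ x₀) * (c * (α - ρ α))) ≤ 1 ∧
      Valued.v (h * (x₀ * Θ x₀) * (c * (α - ρ α)) - ρ (h * (x₀ * Θ x₀) * (c * (α - ρ α)))) ≤ Valued.v (c * (α - ρ α)) :=
    (exists_fixed_coords_iff_mem_order hρρ hα hα1 hint hc hc0 hc1 _).1 ⟨p, q, ⟨hp, hp1⟩, ⟨hq, hq1⟩, hy⟩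
  rw [forall_mem_v_herm_le_one_iff_exists hρρ hvρ hα hα1 hint hΘΘ hΘρ hvΘ hc hc0 hc1 hh hx₀ hΛ m]
  constructor
  · rintro ⟨z, hz, rfl⟩
    -- `z = t + y·w` ⇒ `y⁻¹x₀z = x₀w + t·y⁻¹x₀`
    obtain ⟨t, w, ht, hw, rfl⟩ := exists_fixed_add_mul_of_primitive hρρ hvρ hα hα1 hint hc hc0 hc1 hp hp1 hq hq1 hprim hz
    refine ⟨x₀ * w, t, (hΛ _).2 ⟨w, hw, rfl⟩, ht, ?_⟩
    rw [← hy]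
    field_simp
    ring
  · rintro ⟨a, t, ha, ht, rfl⟩
    obtain ⟨w, hw, rfl⟩ := (hΛ a).1 ha
    refine ⟨t + (h * (x₀ * Θ x₀) * (c * (α - ρ α))) * w, add_mem_order (mem_order_of_fixed c ht.1 ht.2) (mul_mem_order hvρ hyO hw), ?_⟩
    field_simp
    ring

/-! ## §3 (B) The double dual: `Λ^## = Λ` -/

/-- `Θ(y)∕y` for `y = h·x₀Θ(x₀)·c(α − ρα)` (`Θh = h`) is `(Θc∕c)·b(Θα)`, a fixed UNIT of every order: it lies in the order of conductor `c` and has value `1`.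
[cite: Jacobowitz1962, §4] -/
theorem theta_div_mem_order_and_v_eq_one (hρρ : ∀ x, ρ (ρ x) = x) (hα : ρ α ≠ α)
    (hΘΘ : ∀ x, Θ (Θ x) = x) (hΘρ : ∀ x, Θ (ρ x) = ρ (Θ x)) (hvΘ : ∀ x, Valued.v (Θ x) = Valued.v x)
    {c : K} (hc : ρ c = c) (hc0 : c ≠ 0) {h : K} (hΘh : Θ h = h) (hh : h ≠ 0) {x₀ : K} (hx₀ : x₀ ≠ 0) :
    (Valued.v (Θ (h * (x₀ * Θ x₀) * (c * (α - ρ α))) / (h * (x₀ * Θ x₀) * (c * (α - ρ α)))) ≤ 1 ∧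
        Valued.v (Θ (h * (x₀ * Θ x₀) * (c * (α - ρ α))) / (h * (x₀ * Θ x₀) * (c * (α - ρ α))) -
            ρ (Θ (h * (x₀ * Θ x₀) * (c * (α - ρ α))) / (h * (x₀ * Θ x₀) * (c * (α - ρ α))))) ≤ Valued.v (c * (α - ρ α))) ∧
      Valued.v (Θ (h * (x₀ * Θ x₀) * (c * (α - ρ α))) / (h * (x₀ * Θ x₀) * (c * (α - ρ α)))) = 1 := by
  have hd : α - ρ α ≠ 0 := sub_ne_zero.2 (Ne.symm hα)
  have hΘx₀ : Θ x₀ ≠ 0 := (map_ne_zero Θ).2 hx₀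
  have hy0 : h * (x₀ * Θ x₀) * (c * (α - ρ α)) ≠ 0 := mul_ne_zero (mul_ne_zero hh (mul_ne_zero hx₀ hΘx₀)) (mul_ne_zero hc0 hd)
  -- the quotient is `Θ(c(α − ρα)) ∕ (c(α − ρα))`, a FIXED element of value `1`
  have hquot : Θ (h * (x₀ * Θ x₀) * (c * (α - ρ α))) / (h * (x₀ * Θ x₀) * (c * (α - ρ α))) = Θ (c * (α - ρ α)) / (c * (α - ρ α)) := by
    rw [map_mul Θ (h * (x₀ * Θ x₀)) (c * (α - ρ α)), map_mul Θ h, map_mul Θ x₀, hΘh, hΘΘ, mul_comm (Θ x₀) x₀,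
      mul_div_mul_left _ _ (mul_ne_zero hh (mul_ne_zero hx₀ hΘx₀))]
  have hfix : ρ (Θ (c * (α - ρ α)) / (c * (α - ρ α))) = Θ (c * (α - ρ α)) / (c * (α - ρ α)) := by
    rw [map_div₀, ← hΘρ, map_mul ρ, hc, map_sub_map_eq_neg hρρ, mul_neg, map_neg, neg_div_neg_eq]
  have hval : Valued.v (Θ (c * (α - ρ α)) / (c * (α - ρ α))) = 1 := by
    rw [map_div₀, hvΘ, div_self ((Valuation.ne_zero_iff _).2 (mul_ne_zero hc0 hd))]
  rw [hquot]
  exact ⟨mem_order_of_fixed c hfix hval.le, hval⟩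

/-- **(B) `Λ^## = Λ`**: for `Λ = x₀·𝒪_c` with dual `Λ′ = y⁻¹x₀·𝒪_c` (ANY presentation `hΛ′`), the hermitian dual of `Λ′` is `Λ` again — the dual generator of `Λ′` is `Θ(y)⁻¹`
(★ T4c at `x₀′ = y⁻¹x₀`), and `Θ(y)∕y` is a fixed unit of `𝒪_c`. [cite: Jacobowitz1962, §4] -/
theorem forall_mem_dual_herm_iff_mem (hρρ : ∀ x, ρ (ρ x) = x) (hvρ : ∀ x, Valued.v (ρ x) = Valued.v x) (hα : ρ α ≠ α) (hα1 : Valued.v α ≤ 1)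
    (hint : ∀ z : K, Valued.v z ≤ 1 → Valued.v ((z - ρ z) / (α - ρ α)) ≤ 1)
    (hΘΘ : ∀ x, Θ (Θ x) = x) (hΘρ : ∀ x, Θ (ρ x) = ρ (Θ x)) (hvΘ : ∀ x, Valued.v (Θ x) = Valued.v x)
    {c : K} (hc : ρ c = c) (hc0 : c ≠ 0) (hc1 : Valued.v c ≤ 1) {h : K} (hΘh : Θ h = h) (hh : h ≠ 0) {Λ Λ' : AddSubgroup K} {x₀ : K} (hx₀ : x₀ ≠ 0)
    (hΛ : ∀ x, x ∈ Λ ↔ ∃ z, (Valued.v z ≤ 1 ∧ Valued.v (z - ρ z) ≤ Valued.v (c * (α - ρ α))) ∧ x = x₀ * z)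
    (hΛ' : ∀ x, x ∈ Λ' ↔ ∃ z, (Valued.v z ≤ 1 ∧ Valued.v (z - ρ z) ≤ Valued.v (c * (α - ρ α))) ∧ x = ((h * (x₀ * Θ x₀) * (c * (α - ρ α)))⁻¹ * x₀) * z)
    (m : K) :
    (∀ a ∈ Λ', Valued.v (h * Θ a * m + ρ (h * Θ a * m)) ≤ 1) ↔ m ∈ Λ := by
  set y := h * (x₀ * Θ x₀) * (c * (α - ρ α)) with hydef
  have hd : α - ρ α ≠ 0 := sub_ne_zero.2 (Ne.symm hα)
  have hΘx₀ : Θ x₀ ≠ 0 := (map_ne_zero Θ).2 hx₀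
  have hy0 : y ≠ 0 := mul_ne_zero (mul_ne_zero hh (mul_ne_zero hx₀ hΘx₀)) (mul_ne_zero hc0 hd)
  have hΘy0 : Θ y ≠ 0 := (map_ne_zero Θ).2 hy0
  have hx₀' : y⁻¹ * x₀ ≠ 0 := mul_ne_zero (inv_ne_zero hy0) hx₀
  -- the dual generator of `Λ′` is `Θ(y)⁻¹`
  have hΘy : Θ y = h * (Θ x₀ * x₀) * Θ (c * (α - ρ α)) := by rw [hydef, map_mul Θ, map_mul Θ (h), map_mul Θ x₀, hΘh, hΘΘ]
  have hΘcd : Θ (c * (α - ρ α)) ≠ 0 := (map_ne_zero Θ).2 (mul_ne_zero hc0 hd)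
  have hy' : h * ((y⁻¹ * x₀) * Θ (y⁻¹ * x₀)) * (c * (α - ρ α)) = (Θ y)⁻¹ := by
    rw [map_mul Θ, map_inv₀, hΘy, hydef]
    field_simp
  rw [forall_mem_v_herm_le_one_iff_exists hρρ hvρ hα hα1 hint hΘΘ hΘρ hvΘ hc hc0 hc1 hh hx₀' hΛ' m, hy', inv_inv, hΛ m]
  obtain ⟨hunitO, hunit1⟩ := theta_div_mem_order_and_v_eq_one hρρ hα hΘΘ hΘρ hvΘ hc hc0 hΘh hh hx₀
  have hunitO' : Valued.v ((Θ y / y)⁻¹) ≤ 1 ∧ Valued.v ((Θ y / y)⁻¹ - ρ ((Θ y / y)⁻¹)) ≤ Valued.v (c * (α - ρ α)) := by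
    have hne : Θ y / y ≠ 0 := div_ne_zero hΘy0 hy0
    have hρne : ρ (Θ y / y) ≠ 0 := (map_ne_zero ρ).2 hne
    have hrew : (Θ y / y)⁻¹ = ρ (Θ y / y) * ((Θ y / y) * ρ (Θ y / y))⁻¹ := by field_simp
    rw [hrew]
    refine mul_mem_order hvρ (map_mem_order hρρ hvρ hunitO) (mem_order_of_fixed c ?_ ?_)
    · rw [map_inv₀, map_mul_map_self hρρ]
    · rw [map_inv₀, map_mul, hvρ, hunit1, mul_one, inv_one]
  constructor
  · rintro ⟨z, hz, rfl⟩
    refine ⟨(Θ y / y) * z, mul_mem_order hvρ hunitO hz, ?_⟩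
    field_simp
  · rintro ⟨z, hz, rfl⟩
    refine ⟨(Θ y / y)⁻¹ * z, mul_mem_order hvρ hunitO' hz, ?_⟩
    field_simp

/-! ## §4 (C′) The value of the dual generator -/

omit [Valued K ℤᵐ⁰] in
/-- **(C′) THE DUAL GENERATOR'S SELF-PAIRING**: for `y = h·x₀Θ(x₀)·c(α − ρα)` (`Θh = h`, `y ≠ 0`) and `w₀ = y⁻¹x₀`:
`h·Θ(w₀)·w₀ + ρ(h·Θ(w₀)·w₀) = (ρy − y) ∕ (y·ρy·Θ(c(α − ρα)))` (`hΘ(w₀)w₀ = (y·Θ(c(α − ρα)))⁻¹`, and `ρΘ(c(α − ρα)) = −Θ(c(α − ρα))`). [cite: Serre1979, Ch. V §3] [cite: Jacobowitz1962, §4] -/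
theorem herm_dualGen_inv_eq (hρρ : ∀ x, ρ (ρ x) = x) (hα : ρ α ≠ α) (hΘΘ : ∀ x, Θ (Θ x) = x) (hΘρ : ∀ x, Θ (ρ x) = ρ (Θ x))
    {c : K} (hc : ρ c = c) (hc0 : c ≠ 0) {h : K} (hΘh : Θ h = h) (hh : h ≠ 0) {x₀ : K} (hx₀ : x₀ ≠ 0) :
    h * Θ ((h * (x₀ * Θ x₀) * (c * (α - ρ α)))⁻¹ * x₀) * ((h * (x₀ * Θ x₀) * (c * (α - ρ α)))⁻¹ * x₀) +
        ρ (h * Θ ((h * (x₀ * Θ x₀) * (c * (α - ρ α)))⁻¹ * x₀) * ((h * (x₀ * Θ x₀) * (c * (α - ρ α)))⁻¹ * x₀)) =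
      (ρ (h * (x₀ * Θ x₀) * (c * (α - ρ α))) - h * (x₀ * Θ x₀) * (c * (α - ρ α))) /
        ((h * (x₀ * Θ x₀) * (c * (α - ρ α))) * ρ (h * (x₀ * Θ x₀) * (c * (α - ρ α))) * Θ (c * (α - ρ α))) := by
  set y := h * (x₀ * Θ x₀) * (c * (α - ρ α)) with hydef
  have hd : α - ρ α ≠ 0 := sub_ne_zero.2 (Ne.symm hα)
  have hcd : c * (α - ρ α) ≠ 0 := mul_ne_zero hc0 hd
  have hΘx₀ : Θ x₀ ≠ 0 := (map_ne_zero Θ).2 hx₀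
  have hy0 : y ≠ 0 := mul_ne_zero (mul_ne_zero hh (mul_ne_zero hx₀ hΘx₀)) hcd
  have hρy0 : ρ y ≠ 0 := (map_ne_zero ρ).2 hy0
  have hΘcd : Θ (c * (α - ρ α)) ≠ 0 := (map_ne_zero Θ).2 hcd
  -- `hΘ(w₀)w₀ = (y·Θ(c(α − ρα)))⁻¹`
  have hΘy : Θ y = h * (Θ x₀ * x₀) * Θ (c * (α - ρ α)) := by rw [hydef, map_mul Θ, map_mul Θ (h), map_mul Θ x₀, hΘh, hΘΘ]
  have hu : h * Θ (y⁻¹ * x₀) * (y⁻¹ * x₀) = (y * Θ (c * (α - ρ α)))⁻¹ := by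
    rw [map_mul Θ, map_inv₀, hΘy, hydef]
    field_simp
  -- `ρ(Θ(c(α − ρα))) = −Θ(c(α − ρα))`
  have hρΘ : ρ (Θ (c * (α - ρ α))) = -Θ (c * (α - ρ α)) := by
    rw [← hΘρ, map_mul ρ, hc, map_sub_map_eq_neg hρρ, mul_neg, map_neg]
  rw [hu, map_inv₀, map_mul ρ y, hρΘ]
  field_simp
  ring

/-- **(C′) THE VALUE OF THE DUAL GENERATOR**: `|h·Θ(w₀)·w₀ + ρ(h·Θ(w₀)·w₀)| = |y − ρy| ∕ (|y|²·|c(α − ρα)|)` for `w₀ = y⁻¹x₀` (`ρ`, `Θ` isometric). [cite: Jacobowitz1962, §4] -/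
theorem v_herm_dualGen_inv_eq (hρρ : ∀ x, ρ (ρ x) = x) (hvρ : ∀ x, Valued.v (ρ x) = Valued.v x) (hα : ρ α ≠ α)
    (hΘΘ : ∀ x, Θ (Θ x) = x) (hΘρ : ∀ x, Θ (ρ x) = ρ (Θ x)) (hvΘ : ∀ x, Valued.v (Θ x) = Valued.v x)
    {c : K} (hc : ρ c = c) (hc0 : c ≠ 0) {h : K} (hΘh : Θ h = h) (hh : h ≠ 0) {x₀ : K} (hx₀ : x₀ ≠ 0) :
    Valued.v (h * Θ ((h * (x₀ * Θ x₀) * (c * (α - ρ α)))⁻¹ * x₀) * ((h * (x₀ * Θ x₀) * (c * (α - ρ α)))⁻¹ * x₀) +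
        ρ (h * Θ ((h * (x₀ * Θ x₀) * (c * (α - ρ α)))⁻¹ * x₀) * ((h * (x₀ * Θ x₀) * (c * (α - ρ α)))⁻¹ * x₀))) =
      Valued.v (h * (x₀ * Θ x₀) * (c * (α - ρ α)) - ρ (h * (x₀ * Θ x₀) * (c * (α - ρ α)))) /
        (Valued.v (h * (x₀ * Θ x₀) * (c * (α - ρ α))) ^ 2 * Valued.v (c * (α - ρ α))) := by
  rw [herm_dualGen_inv_eq hρρ hα hΘΘ hΘρ hc hc0 hΘh hh hx₀, map_div₀, Valuation.map_sub_swap, Valuation.map_mul, Valuation.map_mul, hvρ, hvΘ, sq]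

/-- **EXACT `ρ`-DEPTH FROM A UNIT `q`-COORDINATE**: if `y = p + q·(cα)` with `p, q` fixed and `|q| = 1`, then `|y − ρy| = |c(α − ρα)|` (`y − ρy = q·c(α − ρα)`).
[cite: Serre1979, Ch. V §3] -/
theorem v_sub_map_eq_of_coord_unit {c : K} (hc : ρ c = c) {p q : K} (hp : ρ p = p) (hq : ρ q = q) (hqu : Valued.v q = 1) :
    Valued.v ((p + q * (c * α)) - ρ (p + q * (c * α))) = Valued.v (c * (α - ρ α)) := by
  have hrew : (p + q * (c * α)) - ρ (p + q * (c * α)) = q * (c * (α - ρ α)) := by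
    rw [map_add, map_mul, map_mul, hp, hq, hc]; ring
  rw [hrew, map_mul, hqu, one_mul]

/-- If `|p| = 1 ∨ |q| = 1` (primitive) and `|p + q·(cα)| < 1` while `|cα| < 1`, then `|q| = 1` (otherwise `|p| = 1` and the sum has value `1`). [cite: Serre1979, Ch. V §3] -/
theorem v_coord_eq_one_of_v_lt_one {c p q : K} (hq1 : Valued.v q ≤ 1) (hprim : Valued.v p = 1 ∨ Valued.v q = 1)
    (hcα : Valued.v (c * α) < 1) (hy : Valued.v (p + q * (c * α)) < 1) : Valued.v q = 1 := by
  rcases hprim with hpu | hqu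
  · exfalso
    have hsmall : Valued.v (q * (c * α)) < 1 := by
      rw [map_mul]
      calc Valued.v q * Valued.v (c * α) ≤ 1 * Valued.v (c * α) := mul_le_mul' hq1 le_rfl
        _ = Valued.v (c * α) := one_mul _
        _ < 1 := hcα
    have hval : Valued.v (p + q * (c * α)) = 1 := by
      rw [Valuation.map_add_of_distinct_val _ (by rw [hpu]; exact hsmall.ne'), hpu, max_eq_left hsmall.le]
    rw [hval] at hy
    exact lt_irrefl _ hy
  · exact hqu

/-- **(C′) OFF LEVEL ZERO THE DUAL GENERATOR PAIRS TO `|y|⁻²`**: for a primitive `y = p + q·(cα)` with `|y| < 1` and `|cα| < 1`: `|⟨w₀, w₀⟩|·|y|² = 1` — the tube coordinate `b`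
of the payer's T2b (`|⟨w₀, w₀⟩| = |ϖ|^{−2b}`) IS the level `|y| = |ϖ|^b`. [cite: Jacobowitz1962, §4] -/
theorem v_herm_dualGen_inv_mul_sq_eq_one (hρρ : ∀ x, ρ (ρ x) = x) (hvρ : ∀ x, Valued.v (ρ x) = Valued.v x) (hα : ρ α ≠ α)
    (hΘΘ : ∀ x, Θ (Θ x) = x) (hΘρ : ∀ x, Θ (ρ x) = ρ (Θ x)) (hvΘ : ∀ x, Valued.v (Θ x) = Valued.v x)
    {c : K} (hc : ρ c = c) (hc0 : c ≠ 0) {h : K} (hΘh : Θ h = h) (hh : h ≠ 0) {x₀ : K} (hx₀ : x₀ ≠ 0)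
    {p q : K} (hp : ρ p = p) (hq : ρ q = q) (hq1 : Valued.v q ≤ 1) (hprim : Valued.v p = 1 ∨ Valued.v q = 1)
    (hy : h * (x₀ * Θ x₀) * (c * (α - ρ α)) = p + q * (c * α)) (hcα : Valued.v (c * α) < 1) (hy1 : Valued.v (h * (x₀ * Θ x₀) * (c * (α - ρ α))) < 1) :
    Valued.v (h * Θ ((h * (x₀ * Θ x₀) * (c * (α - ρ α)))⁻¹ * x₀) * ((h * (x₀ * Θ x₀) * (c * (α - ρ α)))⁻¹ * x₀) +
        ρ (h * Θ ((h * (x₀ * Θ x₀) * (c * (α - ρ α)))⁻¹ * x₀) * ((h * (x₀ * Θ x₀) * (c * (α - ρ α)))⁻¹ * x₀))) *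
      Valued.v (h * (x₀ * Θ x₀) * (c * (α - ρ α))) ^ 2 = 1 := by
  have hd : α - ρ α ≠ 0 := sub_ne_zero.2 (Ne.symm hα)
  have hcd : c * (α - ρ α) ≠ 0 := mul_ne_zero hc0 hd
  have hΘx₀ : Θ x₀ ≠ 0 := (map_ne_zero Θ).2 hx₀
  have hy0 : h * (x₀ * Θ x₀) * (c * (α - ρ α)) ≠ 0 := mul_ne_zero (mul_ne_zero hh (mul_ne_zero hx₀ hΘx₀)) hcd
  have hvy : Valued.v (h * (x₀ * Θ x₀) * (c * (α - ρ α))) ≠ 0 := (Valuation.ne_zero_iff _).2 hy0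
  have hvcd : Valued.v (c * (α - ρ α)) ≠ 0 := (Valuation.ne_zero_iff _).2 hcd
  have hqu : Valued.v q = 1 := v_coord_eq_one_of_v_lt_one hq1 hprim hcα (by rw [← hy]; exact hy1)
  have hdepth : Valued.v (h * (x₀ * Θ x₀) * (c * (α - ρ α)) - ρ (h * (x₀ * Θ x₀) * (c * (α - ρ α)))) = Valued.v (c * (α - ρ α)) := by
    rw [hy]; exact v_sub_map_eq_of_coord_unit hc hp hq hqu
  rw [v_herm_dualGen_inv_eq hρρ hvρ hα hΘΘ hΘρ hvΘ hc hc0 hΘh hh hx₀, hdepth, div_mul_eq_mul_div,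
    div_eq_iff (mul_ne_zero (pow_ne_zero 2 hvy) hvcd), one_mul]
  exact mul_comm _ _

end Literature.NumberTheory.LocalFields.QuadraticOrder
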